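import Summits.CriticalPhenomena.PercolationContinuityZ3.Theorems.PercNearOneGluingNoHeavyLowerTailSunflowerCompositionOuter
import Summits.CriticalPhenomena.PercolationContinuityZ3.Theorems.PercNearOneGluingNoHeavyLowerTailSunflowerCoreCounts
import HarnessLib
import HarnessLib.Audit

/-!
# `NoHeavyLowerTail` (crux stmt-CriticalPhenomena-4575), abstract sunflower cubic: the two TIGHT FAMILIES of the partition lemma —
# Lemma B is an IDENTITY on every product-type composition and Lemma A is an IDENTITY on every star-type composition, so that
# `ZH = 3·SA` on products and `ZH = 3·SB` on stars (exact values of the `H`-row partition functional)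

Support file (seat `prim-l12-p2` gen 12; `--supports stmt-CriticalPhenomena-4575`).  Nothing is asserted about the crux; no `sorry`, no named
facts.  Memo: run/shared/lean/prim/prim-l12/prim-l12-p2/FINDING-g12-TIGHT-FAMILIES-AND-DICHOTOMY.md.

SETTING (companions `…SunflowerCoreCounts` (prove-1 gen 29), `…SunflowerComposition*` (gen 9/11)): for a sunflower `F` (monotone map
`2^α → M₃`) the `H`-row partition functional splits as `ZH = 3(SA + SB) − Ntri = 6(NAA + NBB + N123 − NV − ND)` with `3·SA − Ntri = 6(NAA − NV)`
("Lemma A slack": kernel-spectator antipodal-Gladkov slack minus rainbows) and `3·SB − Ntri = 6(NBB − ND)` ("Lemma B slack").  Neither Lemma A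
(`NV ≤ NAA`) nor Lemma B (`ND ≤ NBB`) holds in general (doubled star / products), and the partition lemma `PartitionLemmaH` is their SUM.

THIS FILE (kernel-generic composition calculus of `…SunflowerComposition`, two finite fibre computations by `decide`):
* the kernels `kB := dind − pairB`, `kA := vind − pairA` (inline lambdas) of `ND − NBB` and `NV − NAA` (`Sunflower.Zp_kB`, `Sunflower.Zp_kA`).
* `ZF_kB_prodOuter`, `ZF_kA_starOuter` — EVERY three-copy fibre of `kB` on the product-type outer map `θ = prodOuter`, and of `kA` on the
  star-type outer map `θ' = starOuter`, VANISHES (64 size profiles each, `decide +kernel`; impossible profiles by `ZF_eq_zero_of_three_lt`).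
* **`ND_eq_NBB_prodOuter_compose`** — for arbitrary monotone Boolean gadgets `h₁,h₂,h₃` on disjoint blocks (petals on disjoint supports:
  AND/OR-products and all their generalisations), Lemma B is an IDENTITY: `ND = NBB`, i.e. `3·SB = Ntri` (`three_SB_eq_Ntri_prodOuter_compose`),
  hence **`ZH = 3·SA`** (`ZH_eq_three_SA_prodOuter_compose`): on products the `H`-row functional is EXACTLY three times the kernel-spectator
  Gladkov slack (prove-1 g25's observation (R0), here kernel-checked for every gadget).
* **`NV_eq_NAA_starOuter_compose`** — dually, on every star-type composition (`{j ∼ k}_i` stars with arbitrary arms; the family violating Lemma B)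
  Lemma A is an identity: `NV = NAA`, `3·SA = Ntri`, **`ZH = 3·SB`** (a composition-calculus proof of the statement prove-1 g29 obtained for `StarData`
  by an explicit block-switching bijection, `…SunflowerStarComposition`).
Consequently products are tight for the partition lemma exactly when no two disjoint kernel sets exist (`SA = 0`), stars exactly when `SB = 0`;
any proof of `PartitionLemmaH` must interpolate between "kernel slack pays" (stars) and "bottom slack pays" (products) — see the memo for the census
showing that no per-rainbow coverage class decides the payer (three-hub sunflowers).
-/

namespace Summit.CriticalPhenomena.PercolationContinuityZ3.Theorems.SunflowerPartition

open Finset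

/-! ## The two difference kernels `kB := fun x y z => dind x y z - pairB x y` (kernel of `ND − NBB`) and
`kA := fun x y z => vind x y z - pairA x y` (kernel of `NV − NAA`), written inline throughout (no new definitions). -/

section Kernels

variable {α : Type*} [Fintype α] [DecidableEq α]

/-- `Zp kB = ND − NBB`. [this work] -/
theorem Sunflower.Zp_kB (F : Sunflower α) : F.Zp (fun x y z => dind x y z - pairB x y) = F.ND - F.NBB := by
  unfold Sunflower.Zp Sunflower.ND Sunflower.NBB
  rw [← sum_sub_distrib]

/-- `Zp kA = NV − NAA`. [this work] -/
theorem Sunflower.Zp_kA (F : Sunflower α) : F.Zp (fun x y z => vind x y z - pairA x y) = F.NV - F.NAA := by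
  unfold Sunflower.Zp Sunflower.NV Sunflower.NAA
  rw [← sum_sub_distrib]

end Kernels

/-! ## Vanishing of all fibres on the two outer maps -/

section Outer

variable {ι : Type*} [Fintype ι] [DecidableEq ι]

/-- If the `4^ι` fibres with all pattern sizes `≤ 3` vanish, every fibre vanishes. [this work] -/
theorem ZF_eq_zero_of_fin_four (κ : Fin 5 → Fin 5 → Fin 5 → ℤ) (G : Sunflower ι)
    (H : ∀ c : ι → Fin 4, ZF κ G (fun i => ((c i : Fin 4) : ℕ)) = 0) : ∀ c : ι → ℕ, ZF κ G c = 0 := by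
  intro c
  by_cases hc : ∀ i, c i ≤ 3
  · have := H (fun i => ⟨c i, by have := hc i; omega⟩)
    convert this using 2
  · obtain ⟨i, hi⟩ := not_forall.1 hc
    exact ZF_eq_zero_of_three_lt κ G c (lt_of_not_ge hi)

/-- Every fibre of `kB` on the product-type outer map `θ` vanishes (64 profiles, `decide`). [this work] -/
theorem ZF_kB_prodOuter :
    ∀ c : Fin 3 → Fin 4, ZF (fun x y z => dind x y z - pairB x y) prodOuter (fun i => ((c i : Fin 4) : ℕ)) = 0 := by
  decide +kernel

/-- Every fibre of `kA` on the star-type outer map `θ'` vanishes (64 profiles, `decide`). [this work] -/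
theorem ZF_kA_starOuter :
    ∀ c : Fin 3 → Fin 4, ZF (fun x y z => vind x y z - pairA x y) starOuter (fun i => ((c i : Fin 4) : ℕ)) = 0 := by
  decide +kernel

variable {β : ι → Type*} [∀ i, Fintype (β i)] [∀ i, DecidableEq (β i)]

/-- If every fibre of `κ` on `G` vanishes, `Zκ` vanishes on every block substitution into `G` (composition identity
`Zκ(G∘h) = Σ_c (Π n_i(c_i))·ZF_G(c)`). [this work] -/
theorem Sunflower.Zp_compose_eq_zero_of_fibres (G : Sunflower ι) (h : Gadget β) (κ : Fin 5 → Fin 5 → Fin 5 → ℤ)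
    (hc : ∀ c : ι → ℕ, ZF κ G c = 0) : (G.compose h).Zp κ = 0 := by
  rw [Sunflower.Zp_compose_eq_sum_ZF]
  exact sum_eq_zero fun c _ => by rw [hc c, mul_zero]

end Outer

/-! ## The two tight families -/

section Main

variable {β : Fin 3 → Type*} [∀ i, Fintype (β i)] [∀ i, DecidableEq (β i)]

/-- **Lemma B is an identity on every product-type composition**: `ND = NBB` for `θ ∘ (h₁,h₂,h₃)` with arbitrary monotone Boolean gadgets on
disjoint blocks. [this work] -/
theorem ND_eq_NBB_prodOuter_compose (h : Gadget β) : (prodOuter.compose h).ND = (prodOuter.compose h).NBB := by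
  have h0 : (prodOuter.compose h).Zp (fun x y z => dind x y z - pairB x y) = 0 :=
    prodOuter.Zp_compose_eq_zero_of_fibres h _ (ZF_eq_zero_of_fin_four _ prodOuter ZF_kB_prodOuter)
  rw [Sunflower.Zp_kB] at h0
  linarith

/-- On product-type compositions the bottom-spectator Gladkov slack pays for the rainbows EXACTLY: `3·SB = Ntri`. [this work] -/
theorem three_SB_eq_Ntri_prodOuter_compose (h : Gadget β) : 3 * (prodOuter.compose h).SB = (prodOuter.compose h).Ntri := by
  have h1 := (prodOuter.compose h).three_SB_sub_Ntri
  have h2 := ND_eq_NBB_prodOuter_compose h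
  linarith

/-- **Exact value of the `H`-row functional on products**: `ZH (θ ∘ h) = 3·SA (θ ∘ h)` — three times the kernel-spectator antipodal-Gladkov slack
(in particular `≥ 0`, and `= 0` iff no kernel spectator has slack). [this work] -/
theorem ZH_eq_three_SA_prodOuter_compose (h : Gadget β) : (prodOuter.compose h).ZH = 3 * (prodOuter.compose h).SA := by
  have h1 := (prodOuter.compose h).ZH_eq_SA_SB
  have h2 := three_SB_eq_Ntri_prodOuter_compose h
  linarith

/-- **Lemma A is an identity on every star-type composition**: `NV = NAA` for `θ' ∘ (h₁,h₂,h₃)`. [this work] -/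
theorem NV_eq_NAA_starOuter_compose (h : Gadget β) : (starOuter.compose h).NV = (starOuter.compose h).NAA := by
  have h0 : (starOuter.compose h).Zp (fun x y z => vind x y z - pairA x y) = 0 :=
    starOuter.Zp_compose_eq_zero_of_fibres h _ (ZF_eq_zero_of_fin_four _ starOuter ZF_kA_starOuter)
  rw [Sunflower.Zp_kA] at h0
  linarith

/-- On star-type compositions the kernel-spectator Gladkov slack pays for the rainbows EXACTLY: `3·SA = Ntri`. [this work] -/
theorem three_SA_eq_Ntri_starOuter_compose (h : Gadget β) : 3 * (starOuter.compose h).SA = (starOuter.compose h).Ntri := by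
  have h1 := (starOuter.compose h).three_SA_sub_Ntri
  have h2 := NV_eq_NAA_starOuter_compose h
  linarith

/-- **Exact value of the `H`-row functional on stars**: `ZH (θ' ∘ h) = 3·SB (θ' ∘ h)`. [this work] -/
theorem ZH_eq_three_SB_starOuter_compose (h : Gadget β) : (starOuter.compose h).ZH = 3 * (starOuter.compose h).SB := by
  have h1 := (starOuter.compose h).ZH_eq_SA_SB
  have h2 := three_SA_eq_Ntri_starOuter_compose h
  linarith

/-- The OR-clone stars `{j ∼ k}_i` with arbitrary group sizes (doubled star, tripled star, …): `ZH = 3·SB`. [this work] -/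
theorem ZH_eq_three_SB_star_orClones (β : Fin 3 → Type*) [∀ i, Fintype (β i)] [∀ i, DecidableEq (β i)] :
    (starOuter.compose (orGadget β)).ZH = 3 * (starOuter.compose (orGadget β)).SB :=
  ZH_eq_three_SB_starOuter_compose (orGadget β)

/-- The AND-products with arbitrary group sizes: `ZH = 3·SA`. [this work] -/
theorem ZH_eq_three_SA_prod_andGroups (β : Fin 3 → Type*) [∀ i, Fintype (β i)] [∀ i, DecidableEq (β i)] :
    (prodOuter.compose (andGadget β)).ZH = 3 * (prodOuter.compose (andGadget β)).SA :=
  ZH_eq_three_SA_prodOuter_compose (andGadget β)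

end Main

/-! ## The exact tight class inside the products: INTERSECTING gadgets give `SA = 0`, hence `ZH = 0`
(appended by prim-l12-p2 gen 12: if no block accepts two disjoint subsets, a kernel block of a partition — which switches on at least two
blocks — leaves at most one generator for the other two (disjoint) blocks, so no kernel spectator sees an antipodal Gladkov pair.) -/

section Tight

variable {β : Fin 3 → Type*} [∀ i, Fintype (β i)] [∀ i, DecidableEq (β i)]

/-- Slices of disjoint sets are disjoint. [this work] -/
theorem slice_disjoint {S T : Finset (Σ i, β i)} (hST : Disjoint S T) (i : Fin 3) : Disjoint (slice S i) (slice T i) := by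
  rw [Finset.disjoint_left] at hST ⊢
  intro b hbS hbT
  rw [mem_slice] at hbS hbT
  exact hST hbS hbT

/-- On the product-type outer map: if `T₀` is a kernel pattern and `T, T'` avoid it, the Gladkov kernel of their labels vanishes
(`T₀` has two of the three generators, so `T, T' ⊆ {k}` are bottom or the petal `k`). [this work] -/
theorem kk_prodOuter_lab_eq_zero_of_disjoint :
    ∀ T₀ T T' : Finset (Fin 3), prodOuter.lab T₀ = 4 → Disjoint T T₀ → Disjoint T' T₀ →
      kk (prodOuter.lab T) (prodOuter.lab T') = 0 := by
  decide

/-- With INTERSECTING gadgets (no block accepts two disjoint subsets), a block disjoint from `P` switches on no block that `P` switches on.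
[this work] -/
theorem hits_disjoint_of_intersecting (h : Gadget β)
    (hint : ∀ i (S T : Finset (β i)), h.h i S = true → h.h i T = true → ¬ Disjoint S T)
    {P Q : Finset (Σ i, β i)} (hPQ : Disjoint Q P) : Disjoint (h.hits Q) (h.hits P) := by
  rw [Finset.disjoint_left]
  intro i hiQ hiP
  rw [Gadget.mem_hits] at hiQ hiP
  exact hint i _ _ hiQ hiP (slice_disjoint hPQ i)

/-- **`SA = 0` on products of intersecting gadgets**: no kernel spectator has antipodal-Gladkov slack. [this work] -/
theorem SA_eq_zero_prodOuter_compose_of_intersecting (h : Gadget β)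
    (hint : ∀ i (S T : Finset (β i)), h.h i S = true → h.h i T = true → ¬ Disjoint S T) :
    (prodOuter.compose h).SA = 0 := by
  unfold Sunflower.SA Sunflower.Sw
  refine sum_eq_zero fun q hq => ?_
  have hq' : Disjoint q.1 q.2 := by
    unfold parts at hq
    exact (mem_filter.1 hq).2
  by_cases h4 : (prodOuter.compose h).lab q.1 = 4
  · have hQ : Disjoint (h.hits q.2) (h.hits q.1) := hits_disjoint_of_intersecting h hint hq'.symm
    have hR : Disjoint (h.hits (q.1 ∪ q.2)ᶜ) (h.hits q.1) := by
      refine hits_disjoint_of_intersecting h hint ?_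
      rw [Finset.disjoint_left]
      intro x hx hx1
      rw [mem_compl] at hx
      exact hx (mem_union_left _ hx1)
    rw [Sunflower.compose_lab] at h4
    simp only [Sunflower.compose_lab]
    rw [kk_prodOuter_lab_eq_zero_of_disjoint _ _ _ h4 hQ hR, mul_zero]
  · simp [h4]

/-- **The partition lemma is TIGHT on every product of intersecting families**: `ZH (θ ∘ h) = 0` (e.g. the triangle of singletons,
AND-blocks, principal filters on disjoint supports). [this work] -/
theorem ZH_eq_zero_prodOuter_compose_of_intersecting (h : Gadget β)
    (hint : ∀ i (S T : Finset (β i)), h.h i S = true → h.h i T = true → ¬ Disjoint S T) :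
    (prodOuter.compose h).ZH = 0 := by
  rw [ZH_eq_three_SA_prodOuter_compose, SA_eq_zero_prodOuter_compose_of_intersecting h hint, mul_zero]

/-- The AND-products with NONEMPTY groups are tight: `ZH = 0`. [this work] -/
theorem ZH_eq_zero_prod_andGroups (β : Fin 3 → Type*) [∀ i, Fintype (β i)] [∀ i, DecidableEq (β i)] [∀ i, Nonempty (β i)] :
    (prodOuter.compose (andGadget β)).ZH = 0 := by
  refine ZH_eq_zero_prodOuter_compose_of_intersecting (andGadget β) fun i S T hS hT hdis => ?_
  simp only [andGadget, decide_eq_true_eq] at hS hT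
  obtain ⟨b⟩ := (inferInstance : Nonempty (β i))
  have hbS : b ∈ S := by rw [hS]; exact mem_univ b
  have hbT : b ∈ T := by rw [hT]; exact mem_univ b
  exact Finset.disjoint_left.1 hdis hbS hbT

end Tight

end Summit.CriticalPhenomena.PercolationContinuityZ3.Theorems.SunflowerPartition
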